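/-
Copyright: the b2b-balaban T⁴-continuum CRUX team, row NE7b OWNER lineage `t4-ne7b-p1` (gen 146). Project licence.
-/
import Summits.QuantumFields.BalabanUV.T4Continuum.Spine.NE7b.SupWeightedFifthOrderLettersFivePart1
import Summits.QuantumFields.BalabanUV.T4Continuum.Spine.NE7b.SupWeightedFifthOrderLettersFivePart2
import Summits.QuantumFields.BalabanUV.T4Continuum.Spine.NE7b.SupWeightedFifthOrderLettersFivePart3
import Summits.QuantumFields.BalabanUV.T4Continuum.Spine.NE7b.SupWeightedFifthOrderLettersFivePart4
import Summits.QuantumFields.BalabanUV.T4Continuum.Spine.NE7b.SupWeightedFifthOrderLettersFivePart5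
import Summits.QuantumFields.BalabanUV.T4Continuum.Spine.NE7b.SupWeightedFifthOrderLettersFivePart6
import Summits.QuantumFields.BalabanUV.T4Continuum.Spine.NE7b.SupWeightedFifthOrderLettersFivePart7
import Summits.QuantumFields.BalabanUV.T4Continuum.Spine.NE7b.SupWeightedFifthOrderLettersFivePart8

/-!
# THE WEIGHTED FIFTH-ORDER SLOT LETTER, SLOT FIVE (`s` fixed) — ASSEMBLY (SCOPING-d17 §F, F13–F17; file (737)).  The
# 8 part letters (files (729)–(736)) cover the 52 terms of the interpolated entry majorant `M₅′` ((687)); this file adds them up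
# into the OUTPUT slot letter of the weighted class at order five, `Σ_{free} M₅′·Π_{pairs}ϑ ≤ letter`, with `M₅′` written exactly as (687)
# prints it (so the output file composes `interpolated_fifth_kernel_entry` with it term for term).  NO support letter, NO finite-range
# hypothesis: the located NO of (648) is repaired at order five (row NE7b, node U5c; (729)–(736) BY NAME; [folklore]).

Cell `pub-balaban`, sub-cell `t4`, spine estimate NE7b (`T4WeightBudget.RelWeightBound`; the cell's OWN estimate — NOT PRINTED in
[Bałaban 1983–89], NOT PROVED).  Crux-route work under `Spine/NE7b/` by the row OWNER (`t4-ne7b-p1` gen 146, file (737)) under FREEZE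
(0)'s crux-prover clause; NOTHING of Bałaban's is named as a Lean object, valued or asserted; no `T4Continuum/Support` leaf typed; no
`def`, no notation (`M₅′` WRITTEN OUT as printed by (687)); zero `sorry`.  Imports (BY NAME): the 8 part files.

WHAT IS PROVED ([folklore]): **`output_k5ϑ_s`**; toy.

HONEST (what this is NOT).  One slot of five; hypotheses = the weighted-class letters of SCOPING-d17 §D∕§F at order five; the `K5` profile
discharges, the output letters (`(687) ∘` this) and the operator letter are later files; scalar skeleton ((A3), NC-NE7b-α UNRULED); nothing
of Bałaban's asserted.  BY-NAME EFFECT ON THE WALL: NONE.  NE7b NOT PRINTED ∕ NOT PROVED; spine PROVED 0∕9; rung (B)+1 — the programme's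
measures remain FINITE-torus statements; NOT the mass gap, NOT Clay.  HONEST DEPENDENCY: continuum YM on T⁴ ⇐ BetaPertH ∧ nine spine estimates
(0∕9 proved); BetaPertH ⇐ (D1) ∧ (D4) ∧ CAP+tail; G-an2-4 gates asym, D1 and NE2∕3∕4.
-/

set_option autoImplicit false
set_option maxSynthPendingDepth 4

noncomputable section

namespace Summit.QuantumFields.BalabanUV.T4Continuum.NE7b.SupWeightedFifthOrderLettersFive

open Finset Real
open scoped BigOperators
open SupWeightedFifthOrderLettersFivePart1 (output_k5ϑ_s_part1)
open SupWeightedFifthOrderLettersFivePart2 (output_k5ϑ_s_part2)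
open SupWeightedFifthOrderLettersFivePart3 (output_k5ϑ_s_part3)
open SupWeightedFifthOrderLettersFivePart4 (output_k5ϑ_s_part4)
open SupWeightedFifthOrderLettersFivePart5 (output_k5ϑ_s_part5)
open SupWeightedFifthOrderLettersFivePart6 (output_k5ϑ_s_part6)
open SupWeightedFifthOrderLettersFivePart7 (output_k5ϑ_s_part7)
open SupWeightedFifthOrderLettersFivePart8 (output_k5ϑ_s_part8)

variable {ι κ : Type} [Fintype ι] [Fintype κ]

variable {Hk : ι → ι → ℝ} {K3 : ι → ι → ι → ℝ} {K4 : ι → ι → ι → ι → ℝ} {K5 : ι → ι → ι → ι → ι → ℝ} {A : Matrix ι κ ℝ} {D : κ → κ → ℝ}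
  {ϑ ϑ₂ ρ r₁ : ι → ι → ℝ} {σ : ι → κ → ℝ} {θ : κ → κ → ℝ}
  {κ₂ γop lam lamA C3k C3h C4 C5 dθ dθ' αθ αθc αg1m αg2m αg1c αk4m1 αk4m2 αk4m3 αk4c αk5m1 αk5m2 αk5m3 αk5m4 αk5c hrϑ hcϑ k3rϑ k3mϑ k3cϑ
    k5ϑ1 k5ϑ2 k5ϑ3 k5ϑ4 k5ϑ5 G Θ8 S2 : ℝ}

set_option synthInstance.maxHeartbeats 200000 in
set_option maxHeartbeats 6000000 in
set_option maxRecDepth 4096 in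
/-- **THE WEIGHTED FIFTH-ORDER SLOT LETTER, `s` FIXED**: the interpolated entry majorant `M₅′` of (687) — 52 terms, written out as
printed there — summed over its four free indices against the full-graph weight `Π_{10 pairs}ϑ`, bounded by the sum of the 8 part letters
(weighted INPUT letters only: `ϑ₂`-weighted `K5`∕`K3`∕`Hk` letters, `σ`-profiles of the `Hk`∕`K3`∕`K4`∕`K5` families, geometry letters
`G`, `Θ8`, `S2`). [folklore] -/
theorem output_k5ϑ_s (hK50 : ∀ a b c d u, 0 ≤ K5 a b c d u) (hK40 : ∀ a b c u, 0 ≤ K4 a b c u) (hK30 : ∀ a b u, 0 ≤ K3 a b u)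
    (hHk0 : ∀ v u, 0 ≤ Hk v u)
    (hD : ∀ x y, 0 ≤ D x y) (hlamA1 : lamA < 1) (hθnn : ∀ z w, 0 ≤ θ z w) (hDθr : ∀ z', ∑ w, D z' w * θ z' w ≤ dθ) (hdθ : 0 ≤ dθ)
    (hDθc : ∀ w, ∑ z', D z' w * θ z' w ≤ dθ') (hdθ' : 0 ≤ dθ') (hσ0 : ∀ x w, 0 ≤ σ x w) (hσθ : ∀ x z' w, σ x w ≤ σ x z' * θ z' w)
    (hϑ1 : ∀ x y, 1 ≤ ϑ x y) (hϑsymm : ∀ x y, ϑ x y = ϑ y x) (hϑmul : ∀ x y z, ϑ x z ≤ ϑ x y * ϑ y z) (hϑ4 : ∀ x y, ϑ x y ^ 4 ≤ ϑ₂ x y)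
    (hϑ₂symm : ∀ x y, ϑ₂ x y = ϑ₂ y x) (hϑσ6 : ∀ x y w, ϑ x y ^ 6 ≤ σ x w * σ y w) (hρ0 : ∀ x y, 0 < ρ x y) (hρsymm : ∀ x y, ρ x y = ρ y x)
    (hr0 : ∀ x y, 0 < r₁ x y) (hr₁symm : ∀ x y, r₁ x y = r₁ y x) (hϑr₁ : ∀ x y, ϑ x y ≤ r₁ x y) (hC50 : 0 ≤ C5)
    (hG : ∀ a, ∑ b, ϑ a b ^ 6 / Real.sqrt (ρ a b) ≤ G) (hΘ : ∀ a, ∑ b, (ϑ a b ^ 4) ^ 2 / ϑ₂ a b ≤ Θ8) (hS2 : ∀ a, ∑ b, ϑ a b ^ 2 / r₁ a b ≤ S2)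
    (hhr : ∀ v, ∑ u, ϑ₂ v u * Hk v u ≤ hrϑ) (hhc : ∀ a, ∑ b, ϑ₂ a b * Hk b a ≤ hcϑ)
    (hk3m : ∀ y, ∑ x, ∑ v, K3 x y v * (ϑ₂ y x * ϑ₂ y v * ϑ₂ x v) ≤ k3mϑ) (hk3c : ∀ v, ∑ y, ∑ z, K3 y z v * (ϑ₂ v y * ϑ₂ v z * ϑ₂ y z) ≤ k3cϑ)
    (hbσ : ∀ v, ∑ z', (∑ u, |A u z'| * Hk v u) * σ v z' ≤ αθ) (hbσc : ∀ z', ∑ v, (∑ u, |A u z'| * Hk v u) * σ v z' ≤ αθc) (hαθc : 0 ≤ αθc)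
    (hg2m : ∀ y, ∑ x, ϑ₂ y x * ∑ z', (∑ u, |A u z'| * K3 x y u) * σ y z' ≤ αg2m)
    (hg1c : ∀ z', ∑ x, ∑ y, (∑ u, |A u z'| * K3 x y u) * (σ x z' * ϑ₂ x y) ≤ αg1c) (hαg1c : 0 ≤ αg1c)
    (hk4m3 : ∀ s, ∑ p, ∑ q, (ϑ₂ s p * ϑ₂ s q * ϑ₂ p q) * ∑ z', (∑ u, |A u z'| * K4 p q s u) * σ s z' ≤ αk4m3)
    (hk4c : ∀ z', ∑ a, ∑ b, ∑ c, (∑ u, |A u z'| * K4 a b c u) * (σ a z' * (ϑ₂ a b * ϑ₂ a c * ϑ₂ b c)) ≤ αk4c) (hαk4c : 0 ≤ αk4c)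
    (hk5m4 : ∀ s, ∑ a, ∑ b, ∑ c, (ϑ₂ s a * ϑ₂ s b * ϑ₂ s c * ϑ₂ a b * ϑ₂ a c * ϑ₂ b c) * ∑ z', (∑ u, |A u z'| * K5 a b c s u) * σ s z' ≤ αk5m4)
    (hk5c : ∀ z', ∑ a, ∑ b, ∑ c, ∑ d, (∑ u, |A u z'| * K5 a b c d u) * (σ a z' * (ϑ₂ a b * ϑ₂ a c * ϑ₂ a d * ϑ₂ b c * ϑ₂ b d * ϑ₂ c d)) ≤ αk5c)
    (hαk5c : 0 ≤ αk5c)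
    (hk5 : ∀ s, ∑ x, ∑ y, ∑ z, ∑ t, K5 y z t s x * (ϑ₂ x y * ϑ₂ x z * ϑ₂ x t * ϑ₂ x s * ϑ₂ y z * ϑ₂ y t * ϑ₂ y s * ϑ₂ z t * ϑ₂ z s * ϑ₂ t s) ≤
          k5ϑ4)
    (s : ι) :
    ∑ x, ∑ y, ∑ z, ∑ t,
        (((K5 y z t s x : ℝ) + (∑ w, (∑ z', D z' w * ∑ u, |A u z'| * Hk x u) * (∑ z', D z' w * ∑ u, |A u z'| * K5 y z t s u) / (1 - lamA) : ℝ)) +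
          ((∑ w, (∑ z', D z' w * ∑ u, |A u z'| * K5 x y t s u) * (∑ z', D z' w * ∑ u, |A u z'| * Hk z u) / (1 - lamA) : ℝ) +
            (∑ w, (∑ z', D z' w * ∑ u, |A u z'| * K3 x z u) * (∑ z', D z' w * ∑ u, |A u z'| * K4 y t s u) / (1 - lamA) : ℝ) +
            (Real.sqrt (2 * K3 t s y * Real.sqrt (5 * (κ₂ ^ 4 * γop ^ 2) / (1 - lam * γop) ^ 2) * C3k) / Real.sqrt (ρ x y * ρ x z) : ℝ) +
            (∑ w, (∑ z', D z' w * ∑ u, |A u z'| * K5 x y z s u) * (∑ z', D z' w * ∑ u, |A u z'| * Hk t u) / (1 - lamA) : ℝ) +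
            (∑ w, (∑ z', D z' w * ∑ u, |A u z'| * K3 x t u) * (∑ z', D z' w * ∑ u, |A u z'| * K4 y z s u) / (1 - lamA) : ℝ) +
            (Real.sqrt (2 * K3 z s y * Real.sqrt (5 * (κ₂ ^ 4 * γop ^ 2) / (1 - lam * γop) ^ 2) * C3k) / Real.sqrt (ρ x y * ρ x t) : ℝ) +
            (∑ w, (∑ z', D z' w * ∑ u, |A u z'| * K5 x y z t u) * (∑ z', D z' w * ∑ u, |A u z'| * Hk s u) / (1 - lamA) : ℝ) +
            (∑ w, (∑ z', D z' w * ∑ u, |A u z'| * K3 x s u) * (∑ z', D z' w * ∑ u, |A u z'| * K4 y z t u) / (1 - lamA) : ℝ) +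
            (Real.sqrt (2 * K3 z t y * Real.sqrt (5 * (κ₂ ^ 4 * γop ^ 2) / (1 - lam * γop) ^ 2) * C3k) / Real.sqrt (ρ x y * ρ x s) : ℝ) +
            (∑ w, (∑ z', D z' w * ∑ u, |A u z'| * K3 x y u) * (∑ z', D z' w * ∑ u, |A u z'| * K4 z t s u) / (1 - lamA) : ℝ) +
            (∑ w, (∑ z', D z' w * ∑ u, |A u z'| * K5 x z t s u) * (∑ z', D z' w * ∑ u, |A u z'| * Hk y u) / (1 - lamA) : ℝ) +
            (Real.sqrt (2 * K3 t s z * Real.sqrt (5 * (κ₂ ^ 4 * γop ^ 2) / (1 - lam * γop) ^ 2) * C3k) / Real.sqrt (ρ x z * ρ x y) : ℝ)) +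
          ((∑ w, (∑ z', D z' w * ∑ u, |A u z'| * K4 x y z u) * (∑ z', D z' w * ∑ u, |A u z'| * K3 t s u) / (1 - lamA) : ℝ) +
            (∑ w, (∑ z', D z' w * ∑ u, |A u z'| * K4 x t s u) * (∑ z', D z' w * ∑ u, |A u z'| * K3 y z u) / (1 - lamA) : ℝ) +
            (Real.sqrt (4 * Hk z y * Hk s t * Real.sqrt (Real.sqrt (5 * (κ₂ ^ 4 * γop ^ 2) / (1 - lam * γop) ^ 2)) * C3h) / Real.sqrt
              (ρ x y * ρ x t) : ℝ) +
            (∑ w, (∑ z', D z' w * ∑ u, |A u z'| * K4 x y t u) * (∑ z', D z' w * ∑ u, |A u z'| * K3 z s u) / (1 - lamA) : ℝ) +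
            (∑ w, (∑ z', D z' w * ∑ u, |A u z'| * K4 x z s u) * (∑ z', D z' w * ∑ u, |A u z'| * K3 y t u) / (1 - lamA) : ℝ) +
            (Real.sqrt (4 * Hk t y * Hk s z * Real.sqrt (Real.sqrt (5 * (κ₂ ^ 4 * γop ^ 2) / (1 - lam * γop) ^ 2)) * C3h) / Real.sqrt
              (ρ x y * ρ x z) : ℝ) +
            (∑ w, (∑ z', D z' w * ∑ u, |A u z'| * K4 x y s u) * (∑ z', D z' w * ∑ u, |A u z'| * K3 z t u) / (1 - lamA) : ℝ) +
            (∑ w, (∑ z', D z' w * ∑ u, |A u z'| * K4 x z t u) * (∑ z', D z' w * ∑ u, |A u z'| * K3 y s u) / (1 - lamA) : ℝ) +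
            (Real.sqrt (4 * Hk s y * Hk t z * Real.sqrt (Real.sqrt (5 * (κ₂ ^ 4 * γop ^ 2) / (1 - lam * γop) ^ 2)) * C3h) / Real.sqrt
              (ρ x y * ρ x z) : ℝ)) +
          ((Real.sqrt (2 * K3 y z x * Real.sqrt (5 * (κ₂ ^ 4 * γop ^ 2) / (1 - lam * γop) ^ 2) * C3k) / Real.sqrt (ρ x t * ρ x s) : ℝ) +
            (Real.sqrt (4 * Hk t x * Hk z y * Real.sqrt (Real.sqrt (5 * (κ₂ ^ 4 * γop ^ 2) / (1 - lam * γop) ^ 2)) * C3h) / Real.sqrt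
              (ρ x y * ρ x s) : ℝ) +
            (Real.sqrt (4 * Hk s x * Hk z y * Real.sqrt (Real.sqrt (5 * (κ₂ ^ 4 * γop ^ 2) / (1 - lam * γop) ^ 2)) * C3h) / Real.sqrt
              (ρ x y * ρ x t) : ℝ) +
            (Real.sqrt
              (16 *
                (8 * Hk z y *
                  (Real.sqrt (5 * (κ₂ ^ 4 * γop ^ 2) / (1 - lam * γop) ^ 2) * Real.sqrt (Real.sqrt (5 * (κ₂ ^ 4 * γop ^ 2) / (1 - lam * γop) ^ 2)))
                  * C4)) * ((r₁ x y)⁻¹ * (r₁ x t)⁻¹ * (r₁ x s)⁻¹ * (r₁ y t)⁻¹ * (r₁ y s)⁻¹ * (r₁ t s)⁻¹) : ℝ) +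
            (Real.sqrt (2 * K3 y t x * Real.sqrt (5 * (κ₂ ^ 4 * γop ^ 2) / (1 - lam * γop) ^ 2) * C3k) / Real.sqrt (ρ x z * ρ x s) : ℝ) +
            (Real.sqrt (4 * Hk z x * Hk t y * Real.sqrt (Real.sqrt (5 * (κ₂ ^ 4 * γop ^ 2) / (1 - lam * γop) ^ 2)) * C3h) / Real.sqrt
              (ρ x y * ρ x s) : ℝ) +
            (Real.sqrt (4 * Hk s x * Hk t y * Real.sqrt (Real.sqrt (5 * (κ₂ ^ 4 * γop ^ 2) / (1 - lam * γop) ^ 2)) * C3h) / Real.sqrt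
              (ρ x y * ρ x z) : ℝ) +
            (Real.sqrt
              (16 *
                (8 * Hk t y *
                  (Real.sqrt (5 * (κ₂ ^ 4 * γop ^ 2) / (1 - lam * γop) ^ 2) * Real.sqrt (Real.sqrt (5 * (κ₂ ^ 4 * γop ^ 2) / (1 - lam * γop) ^ 2)))
                  * C4)) * ((r₁ x y)⁻¹ * (r₁ x z)⁻¹ * (r₁ x s)⁻¹ * (r₁ y z)⁻¹ * (r₁ y s)⁻¹ * (r₁ z s)⁻¹) : ℝ) +
            (Real.sqrt (2 * K3 y s x * Real.sqrt (5 * (κ₂ ^ 4 * γop ^ 2) / (1 - lam * γop) ^ 2) * C3k) / Real.sqrt (ρ x z * ρ x t) : ℝ) +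
            (Real.sqrt (4 * Hk z x * Hk s y * Real.sqrt (Real.sqrt (5 * (κ₂ ^ 4 * γop ^ 2) / (1 - lam * γop) ^ 2)) * C3h) / Real.sqrt
              (ρ x y * ρ x t) : ℝ) +
            (Real.sqrt (4 * Hk t x * Hk s y * Real.sqrt (Real.sqrt (5 * (κ₂ ^ 4 * γop ^ 2) / (1 - lam * γop) ^ 2)) * C3h) / Real.sqrt
              (ρ x y * ρ x z) : ℝ) +
            (Real.sqrt
              (16 *
                (8 * Hk s y *
                  (Real.sqrt (5 * (κ₂ ^ 4 * γop ^ 2) / (1 - lam * γop) ^ 2) * Real.sqrt (Real.sqrt (5 * (κ₂ ^ 4 * γop ^ 2) / (1 - lam * γop) ^ 2)))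
                  * C4)) * ((r₁ x y)⁻¹ * (r₁ x z)⁻¹ * (r₁ x t)⁻¹ * (r₁ y z)⁻¹ * (r₁ y t)⁻¹ * (r₁ z t)⁻¹) : ℝ)) +
          ((Real.sqrt (4 * Hk y x * Hk t z * Real.sqrt (Real.sqrt (5 * (κ₂ ^ 4 * γop ^ 2) / (1 - lam * γop) ^ 2)) * C3h) / Real.sqrt
              (ρ x z * ρ x s) : ℝ) +
            (Real.sqrt (2 * K3 z t x * Real.sqrt (5 * (κ₂ ^ 4 * γop ^ 2) / (1 - lam * γop) ^ 2) * C3k) / Real.sqrt (ρ x y * ρ x s) : ℝ) +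
            (Real.sqrt (4 * Hk s x * Hk t z * Real.sqrt (Real.sqrt (5 * (κ₂ ^ 4 * γop ^ 2) / (1 - lam * γop) ^ 2)) * C3h) / Real.sqrt
              (ρ x z * ρ x y) : ℝ) +
            (Real.sqrt
              (16 *
                (8 * Hk t z *
                  (Real.sqrt (5 * (κ₂ ^ 4 * γop ^ 2) / (1 - lam * γop) ^ 2) * Real.sqrt (Real.sqrt (5 * (κ₂ ^ 4 * γop ^ 2) / (1 - lam * γop) ^ 2)))
                  * C4)) * ((r₁ x z)⁻¹ * (r₁ x y)⁻¹ * (r₁ x s)⁻¹ * (r₁ z y)⁻¹ * (r₁ z s)⁻¹ * (r₁ y s)⁻¹) : ℝ) +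
            (Real.sqrt (4 * Hk y x * Hk s z * Real.sqrt (Real.sqrt (5 * (κ₂ ^ 4 * γop ^ 2) / (1 - lam * γop) ^ 2)) * C3h) / Real.sqrt
              (ρ x z * ρ x t) : ℝ) +
            (Real.sqrt (2 * K3 z s x * Real.sqrt (5 * (κ₂ ^ 4 * γop ^ 2) / (1 - lam * γop) ^ 2) * C3k) / Real.sqrt (ρ x y * ρ x t) : ℝ) +
            (Real.sqrt (4 * Hk t x * Hk s z * Real.sqrt (Real.sqrt (5 * (κ₂ ^ 4 * γop ^ 2) / (1 - lam * γop) ^ 2)) * C3h) / Real.sqrt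
              (ρ x z * ρ x y) : ℝ) +
            (Real.sqrt
              (16 *
                (8 * Hk s z *
                  (Real.sqrt (5 * (κ₂ ^ 4 * γop ^ 2) / (1 - lam * γop) ^ 2) * Real.sqrt (Real.sqrt (5 * (κ₂ ^ 4 * γop ^ 2) / (1 - lam * γop) ^ 2)))
                  * C4)) * ((r₁ x z)⁻¹ * (r₁ x y)⁻¹ * (r₁ x t)⁻¹ * (r₁ z y)⁻¹ * (r₁ z t)⁻¹ * (r₁ y t)⁻¹) : ℝ) +
            (Real.sqrt (4 * Hk y x * Hk s t * Real.sqrt (Real.sqrt (5 * (κ₂ ^ 4 * γop ^ 2) / (1 - lam * γop) ^ 2)) * C3h) / Real.sqrt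
              (ρ x t * ρ x z) : ℝ) +
            (Real.sqrt (2 * K3 t s x * Real.sqrt (5 * (κ₂ ^ 4 * γop ^ 2) / (1 - lam * γop) ^ 2) * C3k) / Real.sqrt (ρ x y * ρ x z) : ℝ) +
            (Real.sqrt (4 * Hk z x * Hk s t * Real.sqrt (Real.sqrt (5 * (κ₂ ^ 4 * γop ^ 2) / (1 - lam * γop) ^ 2)) * C3h) / Real.sqrt
              (ρ x t * ρ x y) : ℝ) +
            (Real.sqrt
              (16 *
                (8 * Hk s t *
                  (Real.sqrt (5 * (κ₂ ^ 4 * γop ^ 2) / (1 - lam * γop) ^ 2) * Real.sqrt (Real.sqrt (5 * (κ₂ ^ 4 * γop ^ 2) / (1 - lam * γop) ^ 2)))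
                  * C4)) * ((r₁ x t)⁻¹ * (r₁ x y)⁻¹ * (r₁ x z)⁻¹ * (r₁ t y)⁻¹ * (r₁ t z)⁻¹ * (r₁ y z)⁻¹) : ℝ)) +
          ((Real.sqrt
              (16 *
                (8 * Hk y x *
                  (Real.sqrt (5 * (κ₂ ^ 4 * γop ^ 2) / (1 - lam * γop) ^ 2) * Real.sqrt (Real.sqrt (5 * (κ₂ ^ 4 * γop ^ 2) / (1 - lam * γop) ^ 2)))
                  * C4)) * ((r₁ x z)⁻¹ * (r₁ x t)⁻¹ * (r₁ x s)⁻¹ * (r₁ z t)⁻¹ * (r₁ z s)⁻¹ * (r₁ t s)⁻¹) : ℝ) +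
            (Real.sqrt
              (16 *
                (8 * Hk z x *
                  (Real.sqrt (5 * (κ₂ ^ 4 * γop ^ 2) / (1 - lam * γop) ^ 2) * Real.sqrt (Real.sqrt (5 * (κ₂ ^ 4 * γop ^ 2) / (1 - lam * γop) ^ 2)))
                  * C4)) * ((r₁ x y)⁻¹ * (r₁ x t)⁻¹ * (r₁ x s)⁻¹ * (r₁ y t)⁻¹ * (r₁ y s)⁻¹ * (r₁ t s)⁻¹) : ℝ) +
            (Real.sqrt
              (16 *
                (8 * Hk t x *
                  (Real.sqrt (5 * (κ₂ ^ 4 * γop ^ 2) / (1 - lam * γop) ^ 2) * Real.sqrt (Real.sqrt (5 * (κ₂ ^ 4 * γop ^ 2) / (1 - lam * γop) ^ 2)))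
                  * C4)) * ((r₁ x y)⁻¹ * (r₁ x z)⁻¹ * (r₁ x s)⁻¹ * (r₁ y z)⁻¹ * (r₁ y s)⁻¹ * (r₁ z s)⁻¹) : ℝ) +
            (Real.sqrt
              (16 *
                (8 * Hk s x *
                  (Real.sqrt (5 * (κ₂ ^ 4 * γop ^ 2) / (1 - lam * γop) ^ 2) * Real.sqrt (Real.sqrt (5 * (κ₂ ^ 4 * γop ^ 2) / (1 - lam * γop) ^ 2)))
                  * C4)) * ((r₁ x y)⁻¹ * (r₁ x z)⁻¹ * (r₁ x t)⁻¹ * (r₁ y z)⁻¹ * (r₁ y t)⁻¹ * (r₁ z t)⁻¹) : ℝ) +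
            (C5 *
              ((r₁ x y)⁻¹ * (r₁ x z)⁻¹ * (r₁ x t)⁻¹ * (r₁ x s)⁻¹ * (r₁ y z)⁻¹ * (r₁ y t)⁻¹ * (r₁ y s)⁻¹ * (r₁ z t)⁻¹ * (r₁ z s)⁻¹ * (r₁ t s)⁻¹) :
              ℝ))) * (ϑ x y * ϑ x z * ϑ x t * ϑ x s * ϑ y z * ϑ y t * ϑ y s * ϑ z t * ϑ z s * ϑ t s) ≤
      (k5ϑ4 + dθ * αk5m4 * (dθ' * αθc) / (1 - lamA) + dθ * αk5m4 * (dθ' * αθc) / (1 - lamA) + dθ * αk4m3 * (dθ' * αg1c) / (1 - lamA) + Real.sqrt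
            (2 * Real.sqrt (5 * (κ₂ ^ 4 * γop ^ 2) / (1 - lam * γop) ^ 2) * C3k) * (Real.sqrt (k3mϑ * (Θ8 * Θ8)) * (G * G)) + dθ * αk5m4 *
            (dθ' * αθc) / (1 - lamA) + dθ * αk4m3 * (dθ' * αg1c) / (1 - lamA) + Real.sqrt
            (2 * Real.sqrt (5 * (κ₂ ^ 4 * γop ^ 2) / (1 - lam * γop) ^ 2) * C3k) * (Real.sqrt (k3mϑ * (Θ8 * Θ8)) * (G * G)) + dθ * αθ *
            (dθ' * αk5c) / (1 - lamA)) +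
          (dθ * αg2m * (dθ' * αk4c) / (1 - lamA) + Real.sqrt (2 * Real.sqrt (5 * (κ₂ ^ 4 * γop ^ 2) / (1 - lam * γop) ^ 2) * C3k) *
            (G * (G * Real.sqrt (k3cϑ * (Θ8 * Θ8)))) + dθ * αk4m3 * (dθ' * αg1c) / (1 - lamA) + dθ * αk5m4 * (dθ' * αθc) / (1 - lamA) + Real.sqrt
            (2 * Real.sqrt (5 * (κ₂ ^ 4 * γop ^ 2) / (1 - lam * γop) ^ 2) * C3k) * (Real.sqrt (k3mϑ * (Θ8 * Θ8)) * (G * G)) + dθ * αg2m *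
            (dθ' * αk4c) / (1 - lamA) + dθ * αk4m3 * (dθ' * αg1c) / (1 - lamA) + Real.sqrt
            (4 * Real.sqrt (Real.sqrt (5 * (κ₂ ^ 4 * γop ^ 2) / (1 - lam * γop) ^ 2)) * C3h) *
            (Real.sqrt (hrϑ * Θ8) * (G * (G * Real.sqrt (hcϑ * Θ8))))) +
          (dθ * αg2m * (dθ' * αk4c) / (1 - lamA) + dθ * αk4m3 * (dθ' * αg1c) / (1 - lamA) + Real.sqrt
            (4 * Real.sqrt (Real.sqrt (5 * (κ₂ ^ 4 * γop ^ 2) / (1 - lam * γop) ^ 2)) * C3h) *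
            (Real.sqrt (hrϑ * Θ8) * (G * (G * Real.sqrt (hcϑ * Θ8)))) + dθ * αk4m3 * (dθ' * αg1c) / (1 - lamA) + dθ * αg2m * (dθ' * αk4c) /
            (1 - lamA) + Real.sqrt (4 * Real.sqrt (Real.sqrt (5 * (κ₂ ^ 4 * γop ^ 2) / (1 - lam * γop) ^ 2)) * C3h) *
            (Real.sqrt (hrϑ * Θ8) * (G * (G * Real.sqrt (hcϑ * Θ8)))) + Real.sqrt
            (2 * Real.sqrt (5 * (κ₂ ^ 4 * γop ^ 2) / (1 - lam * γop) ^ 2) * C3k) * (G * (G * Real.sqrt (k3cϑ * (Θ8 * Θ8)))) + Real.sqrt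
            (4 * Real.sqrt (Real.sqrt (5 * (κ₂ ^ 4 * γop ^ 2) / (1 - lam * γop) ^ 2)) * C3h) *
            (G * (G * (Real.sqrt (hcϑ * Θ8) * Real.sqrt (hcϑ * Θ8))))) +
          (Real.sqrt (4 * Real.sqrt (Real.sqrt (5 * (κ₂ ^ 4 * γop ^ 2) / (1 - lam * γop) ^ 2)) * C3h) *
            (Real.sqrt (hrϑ * Θ8) * (G * (G * Real.sqrt (hcϑ * Θ8)))) + Real.sqrt
            (16 *
              (8 *
                (Real.sqrt (5 * (κ₂ ^ 4 * γop ^ 2) / (1 - lam * γop) ^ 2) * Real.sqrt (Real.sqrt (5 * (κ₂ ^ 4 * γop ^ 2) / (1 - lam * γop) ^ 2)))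
                * C4)) * (S2 * (S2 * (Real.sqrt (hcϑ * Θ8) * S2))) + Real.sqrt
            (2 * Real.sqrt (5 * (κ₂ ^ 4 * γop ^ 2) / (1 - lam * γop) ^ 2) * C3k) * (G * (G * Real.sqrt (k3cϑ * (Θ8 * Θ8)))) + Real.sqrt
            (4 * Real.sqrt (Real.sqrt (5 * (κ₂ ^ 4 * γop ^ 2) / (1 - lam * γop) ^ 2)) * C3h) *
            (G * (G * (Real.sqrt (hcϑ * Θ8) * Real.sqrt (hcϑ * Θ8)))) + Real.sqrt
            (4 * Real.sqrt (Real.sqrt (5 * (κ₂ ^ 4 * γop ^ 2) / (1 - lam * γop) ^ 2)) * C3h) *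
            (Real.sqrt (hrϑ * Θ8) * (G * (G * Real.sqrt (hcϑ * Θ8)))) + Real.sqrt
            (16 *
              (8 *
                (Real.sqrt (5 * (κ₂ ^ 4 * γop ^ 2) / (1 - lam * γop) ^ 2) * Real.sqrt (Real.sqrt (5 * (κ₂ ^ 4 * γop ^ 2) / (1 - lam * γop) ^ 2)))
                * C4)) * (S2 * (S2 * (S2 * Real.sqrt (hcϑ * Θ8)))) + Real.sqrt
            (2 * Real.sqrt (5 * (κ₂ ^ 4 * γop ^ 2) / (1 - lam * γop) ^ 2) * C3k) * (Real.sqrt (k3mϑ * (Θ8 * Θ8)) * (G * G))) +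
          (Real.sqrt (4 * Real.sqrt (Real.sqrt (5 * (κ₂ ^ 4 * γop ^ 2) / (1 - lam * γop) ^ 2)) * C3h) *
            (Real.sqrt (hrϑ * Θ8) * (G * (Real.sqrt (hcϑ * Θ8) * G))) + Real.sqrt
            (4 * Real.sqrt (Real.sqrt (5 * (κ₂ ^ 4 * γop ^ 2) / (1 - lam * γop) ^ 2)) * C3h) *
            (Real.sqrt (hrϑ * Θ8) * (G * (G * Real.sqrt (hcϑ * Θ8)))) + Real.sqrt
            (16 *
              (8 *
                (Real.sqrt (5 * (κ₂ ^ 4 * γop ^ 2) / (1 - lam * γop) ^ 2) * Real.sqrt (Real.sqrt (5 * (κ₂ ^ 4 * γop ^ 2) / (1 - lam * γop) ^ 2)))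
                * C4)) * (Real.sqrt (hrϑ * Θ8) * (S2 * (S2 * S2))) + Real.sqrt
            (4 * Real.sqrt (Real.sqrt (5 * (κ₂ ^ 4 * γop ^ 2) / (1 - lam * γop) ^ 2)) * C3h) *
            (G * (Real.sqrt (hcϑ * Θ8) * (G * Real.sqrt (hcϑ * Θ8)))) + Real.sqrt
            (2 * Real.sqrt (5 * (κ₂ ^ 4 * γop ^ 2) / (1 - lam * γop) ^ 2) * C3k) * (G * (G * Real.sqrt (k3cϑ * (Θ8 * Θ8)))) + Real.sqrt
            (4 * Real.sqrt (Real.sqrt (5 * (κ₂ ^ 4 * γop ^ 2) / (1 - lam * γop) ^ 2)) * C3h) *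
            (Real.sqrt (hrϑ * Θ8) * (G * (G * Real.sqrt (hcϑ * Θ8)))) + Real.sqrt
            (16 *
              (8 *
                (Real.sqrt (5 * (κ₂ ^ 4 * γop ^ 2) / (1 - lam * γop) ^ 2) * Real.sqrt (Real.sqrt (5 * (κ₂ ^ 4 * γop ^ 2) / (1 - lam * γop) ^ 2)))
                * C4)) * (S2 * (S2 * (S2 * Real.sqrt (hcϑ * Θ8))))) +
          (Real.sqrt (4 * Real.sqrt (Real.sqrt (5 * (κ₂ ^ 4 * γop ^ 2) / (1 - lam * γop) ^ 2)) * C3h) *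
            (Real.sqrt (hrϑ * Θ8) * (G * (Real.sqrt (hcϑ * Θ8) * G))) + Real.sqrt
            (2 * Real.sqrt (5 * (κ₂ ^ 4 * γop ^ 2) / (1 - lam * γop) ^ 2) * C3k) * (Real.sqrt (k3mϑ * (Θ8 * Θ8)) * (G * G)) + Real.sqrt
            (4 * Real.sqrt (Real.sqrt (5 * (κ₂ ^ 4 * γop ^ 2) / (1 - lam * γop) ^ 2)) * C3h) *
            (Real.sqrt (hrϑ * Θ8) * (G * (G * Real.sqrt (hcϑ * Θ8)))) + Real.sqrt
            (16 *
              (8 *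
                (Real.sqrt (5 * (κ₂ ^ 4 * γop ^ 2) / (1 - lam * γop) ^ 2) * Real.sqrt (Real.sqrt (5 * (κ₂ ^ 4 * γop ^ 2) / (1 - lam * γop) ^ 2)))
                * C4)) * (Real.sqrt (hrϑ * Θ8) * (S2 * (S2 * S2))) + Real.sqrt
            (4 * Real.sqrt (Real.sqrt (5 * (κ₂ ^ 4 * γop ^ 2) / (1 - lam * γop) ^ 2)) * C3h) *
            (Real.sqrt (hrϑ * Θ8) * (G * (Real.sqrt (hcϑ * Θ8) * G))) + Real.sqrt
            (2 * Real.sqrt (5 * (κ₂ ^ 4 * γop ^ 2) / (1 - lam * γop) ^ 2) * C3k) * (Real.sqrt (k3mϑ * (Θ8 * Θ8)) * (G * G)) + Real.sqrt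
            (4 * Real.sqrt (Real.sqrt (5 * (κ₂ ^ 4 * γop ^ 2) / (1 - lam * γop) ^ 2)) * C3h) *
            (Real.sqrt (hrϑ * Θ8) * (G * (G * Real.sqrt (hcϑ * Θ8))))) +
          (Real.sqrt
            (16 *
              (8 *
                (Real.sqrt (5 * (κ₂ ^ 4 * γop ^ 2) / (1 - lam * γop) ^ 2) * Real.sqrt (Real.sqrt (5 * (κ₂ ^ 4 * γop ^ 2) / (1 - lam * γop) ^ 2)))
                * C4)) * (Real.sqrt (hrϑ * Θ8) * (S2 * (S2 * S2))) + Real.sqrt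
            (16 *
              (8 *
                (Real.sqrt (5 * (κ₂ ^ 4 * γop ^ 2) / (1 - lam * γop) ^ 2) * Real.sqrt (Real.sqrt (5 * (κ₂ ^ 4 * γop ^ 2) / (1 - lam * γop) ^ 2)))
                * C4)) * (S2 * (Real.sqrt (hcϑ * Θ8) * (S2 * S2))) + Real.sqrt
            (16 *
              (8 *
                (Real.sqrt (5 * (κ₂ ^ 4 * γop ^ 2) / (1 - lam * γop) ^ 2) * Real.sqrt (Real.sqrt (5 * (κ₂ ^ 4 * γop ^ 2) / (1 - lam * γop) ^ 2)))
                * C4)) * (S2 * (S2 * (Real.sqrt (hcϑ * Θ8) * S2))) + Real.sqrt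
            (16 *
              (8 *
                (Real.sqrt (5 * (κ₂ ^ 4 * γop ^ 2) / (1 - lam * γop) ^ 2) * Real.sqrt (Real.sqrt (5 * (κ₂ ^ 4 * γop ^ 2) / (1 - lam * γop) ^ 2)))
                * C4)) * (S2 * (S2 * (S2 * Real.sqrt (hcϑ * Θ8)))) + Real.sqrt
            (16 *
              (8 *
                (Real.sqrt (5 * (κ₂ ^ 4 * γop ^ 2) / (1 - lam * γop) ^ 2) * Real.sqrt (Real.sqrt (5 * (κ₂ ^ 4 * γop ^ 2) / (1 - lam * γop) ^ 2)))
                * C4)) * (Real.sqrt (hrϑ * Θ8) * (S2 * (S2 * S2)))) + (C5 * (S2 * (S2 * (S2 * S2)))) := by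
  have q1 := output_k5ϑ_s_part1 (κ₂ := κ₂) (γop := γop) (lam := lam) (C3k := C3k) hK50 hK40 hK30 hHk0 hD hlamA1 hθnn hDθr hdθ hDθc hdθ' hσ0 hσθ
      hϑ1 hϑsymm hϑmul hϑ4 hϑ₂symm hϑσ6 hρ0 hρsymm hG hΘ hk3m hbσ hbσc hαθc hg1c hαg1c hk4m3 hk5m4 hk5c hαk5c hk5 s
  have q2 := output_k5ϑ_s_part2 (κ₂ := κ₂) (γop := γop) (lam := lam) (C3k := C3k) (C3h := C3h) hK50 hK40 hK30 hHk0 hD hlamA1 hθnn hDθr hdθ hDθc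
      hdθ' hσ0 hσθ hϑ1 hϑsymm hϑmul hϑ4 hϑ₂symm hϑσ6 hρ0 hρsymm hG hΘ hhr hhc hk3m hk3c hbσc hαθc hg2m hg1c hαg1c hk4m3 hk4c hαk4c hk5m4 s
  have q3 := output_k5ϑ_s_part3 (κ₂ := κ₂) (γop := γop) (lam := lam) (C3k := C3k) (C3h := C3h) hK40 hK30 hHk0 hD hlamA1 hθnn hDθr hdθ hDθc hdθ'
      hσ0 hσθ hϑ1 hϑsymm hϑmul hϑ4 hϑσ6 hρ0 hρsymm hG hΘ hhr hhc hk3c hg2m hg1c hαg1c hk4m3 hk4c hαk4c s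
  have q4 := output_k5ϑ_s_part4 (κ₂ := κ₂) (γop := γop) (lam := lam) (C3k := C3k) (C3h := C3h) (C4 := C4) hK30 hHk0 hϑ1 hϑsymm hϑmul hϑ4 hϑ₂symm
      hρ0 hρsymm hr0 hr₁symm hϑr₁ hG hΘ hS2 hhr hhc hk3m hk3c s
  have q5 := output_k5ϑ_s_part5 (κ₂ := κ₂) (γop := γop) (lam := lam) (C3k := C3k) (C3h := C3h) (C4 := C4) hK30 hHk0 hϑ1 hϑsymm hϑmul hϑ4 hρ0
      hρsymm hr0 hr₁symm hϑr₁ hG hΘ hS2 hhr hhc hk3c s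
  have q6 := output_k5ϑ_s_part6 (κ₂ := κ₂) (γop := γop) (lam := lam) (C3k := C3k) (C3h := C3h) (C4 := C4) hK30 hHk0 hϑ1 hϑsymm hϑmul hϑ4 hϑ₂symm
      hρ0 hρsymm hr0 hr₁symm hϑr₁ hG hΘ hS2 hhr hhc hk3m s
  have q7 := output_k5ϑ_s_part7 (κ₂ := κ₂) (γop := γop) (lam := lam) (C4 := C4) hHk0 hϑ1 hϑsymm hϑmul hϑ4 hr0 hr₁symm hϑr₁ hΘ hS2 hhr hhc s
  have q8 := output_k5ϑ_s_part8 (C5 := C5) hϑ1 hϑsymm hr0 hr₁symm hϑr₁ hC50 hS2 s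
  simp (config := { maxSteps := 4000000 }) only [add_mul, Finset.sum_add_distrib] at q1 q2 q3 q4 q5 q6 q7 q8 ⊢
  linarith [q1, q2, q3, q4, q5, q6, q7, q8]

/-! ## Toy -/

/-- Toy (the assembly step): part letters add. -/
example (a b c A B C : ℝ) (h1 : a ≤ A) (h2 : b ≤ B) (h3 : c ≤ C) : a + b + c ≤ A + B + C := by linarith

end Summit.QuantumFields.BalabanUV.T4Continuum.NE7b.SupWeightedFifthOrderLettersFive

end
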